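import Mathlib.Analysis.SpecialFunctions.Pow.Real
import Mathlib.Analysis.SpecialFunctions.Exp
import Mathlib.Analysis.Complex.Basic
import Mathlib.Algebra.BigOperators.Group.Finset.Sigma
import Mathlib.Order.Interval.Finset.Nat
import HarnessLib

/-!
# Welsh 2018: Hooley's parametrisation of the roots of `X³ ≡ 2 (mod m)`, their spacing, and a
# two-dimensional large sieve (named facts)

Topic `Literature/NumberTheory/Sieve`; cite item `wi-17789` (route Parity/BatemanHorn
`CubicKloosterman`: cruxes `WeylTypeII`, `WeylTypeI`, supports `GaussDictionaryRoot/Fraction`;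
idea card cubic-roots-large-sieve). Source: M. C. Welsh, *Spacing and a large sieve type
inequality for roots of a cubic congruence*, arXiv:1809.05211 (2018) — Lemma 1 (p. 6), Lemma 2
(p. 7), §4–5 with Theorem 1 (p. 9) and the bound `a, b, c ≪ m^{1/3}` (p. 9), Theorem 2 (p. 11),
Theorem 3 (p. 12).

SETTING. `𝒪 = ℤ[2^{1/3}]` (class number one). By Lemma 1 the roots `ν (mod m)` of
`X³ ≡ 2 (mod m)` correspond to the primitive ideals `I = (α)`, `α = a + b·2^{1/3} + c·2^{2/3}`, of
norm `m = N(α) = a³ + 2b³ + 4c³ - 6abc`; primitivity of `(α)` is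
`gcd(a² - 2bc, 2c² - ab, b² - ac) = 1` ((16)–(17)), and for Bezout data
`u(a² - 2bc) + v(2c² - ab) + w(b² - ac) = 1` Lemma 2 gives the root as
`-ν ≡ a(bw - av) + 2c(au - cw) + 2b(cv - bu) (mod m)`. Choosing `α` in the fundamental domain `𝒟`
of (36) (`α⁻¹ ∈ 𝒟₁ = {β : 2|Nβ|^{1/3} < β⁽¹⁾ ≤ 2ε⁽¹⁾|Nβ|^{1/3}}`, `ε = 1 + 2^{1/3} + 2^{2/3}`) makes
`b² - ac, 2c² - ab, a² - 2bc ≍ m^{2/3}` and `a, b, c ≪ m^{1/3}`, and then (Theorem 1) the three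
rational points `((bu-cv)/(b²-ac), (bv-au)/(b²-ac))`, `((cv-au)/(2c²-ab), (2cu-bv)/(2c²-ab))`,
`((au-bv)/(a²-2bc), (av-2cu)/(a²-2bc))` are within `≪ 1/m` of `(ν/m, ν²/m)` on the torus `ℝ²/ℤ²`.

VENDORED, as three named facts with absolute (existentially quantified) constants, in ELEMENTARY
form — integers `a, b, c, u, v, w` and real inequalities; the number field, its ideals and the
fundamental domain are the device of the proof and do not appear (the conclusions listed are all
that Theorems 2–3 and the route use):
* `Welsh2018_thm1` — ∃ `C` such that every root `ν` of `X³ ≡ 2 (mod m)`, `m ≥ 1`, has such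
  `a, b, c, u, v, w` with (i) `m = a³+2b³+4c³-6abc`, (ii) the Bezout relation, (iii) Lemma 2's
  congruence for `ν`, (iv) `|a|,|b|,|c| ≤ C m^{1/3}`, (v) `m^{2/3}/C ≤ |b²-ac|, |2c²-ab|, |a²-2bc|
  ≤ C m^{2/3}`, (vi) the three points within `C/m` of `(ν/m, ν²/m)` modulo `ℤ²`;
* `Welsh2018_thm2` — ∃ `C` such that for `M ≥ 1` every disc of radius `1/M` on `ℝ²/ℤ²` contains
  the point `(ν/m, ν²/m)` for at most `C` pairs `(m, ν)`, `M < m ≤ 2M`, `0 ≤ ν < m`, `ν³ ≡ 2 (m)`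
  (pairs and points of `S` are in bijection for `M ≥ 1`);
* `Welsh2018_thm3` — the large sieve inequality: ∃ `C` such that for all `M, K, L ≥ 1` and complex
  `a_{k,l}` (`1 ≤ k ≤ K`, `1 ≤ l ≤ L`),
  `∑_{M<m≤2M} ∑_{ν³≡2 (m)} |∑_k ∑_l a_{k,l} e((kν + lν²)/m)|² ≤ C (M+K)(M+L) ∑_k ∑_l |a_{k,l}|²`,
  `e(t) = exp(2πit)` (optimal for `K, L ≥ M`, worse than trivial for `KL ≤ M`, p. 12).

NOT vendored: Lemma 1's lattice basis / the bijection with primitive ideals as such, Lemmas 3–4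
(spacing of approximants via `SL₃(ℤ)` completions), the closed form of the numerators (route
support `GaussDictionaryFraction`), any statement for `X³ ≡ k` with `k ≠ 2`.

## References
* [Welsh2018CubicCongruenceSpacing] as above; read via `lit read arxiv:1809.05211` (TeX chunks
  6–12: §2 Lemma 1, §3 Lemma 2, §4 approximations, §5 fundamental domain + Theorem 1 + the
  `m^{1/3}` bound, §6 Theorem 2, §7 Theorem 3 with its proof by duality).
* C. Hooley, *On the greatest prime factor of a cubic polynomial*, J. reine angew. Math. 303/304
  (1978) 21–50 (the original parametrisation). [Hooley1978CubicPrimeFactor]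
-/

noncomputable section

namespace Literature.NumberTheory.Sieve

namespace Welsh2018

/-- The roots of `X³ ≡ 2 (mod m)` among `0, …, m-1` (empty for `m = 0`).
[cite: Welsh2018CubicCongruenceSpacing, §1] -/
def cubicRoots (m : ℕ) : Finset ℕ :=
  (Finset.range m).filter fun ν : ℕ => (m : ℤ) ∣ (ν : ℤ) ^ 3 - 2

/-- Membership in `cubicRoots`. [folklore] -/
theorem mem_cubicRoots {m ν : ℕ} : ν ∈ cubicRoots m ↔ ν < m ∧ (m : ℤ) ∣ (ν : ℤ) ^ 3 - 2 := by
  simp [cubicRoots]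

/-- The point `(x, y) ∈ ℝ²` is within `r` of `(x₀, y₀)` on the torus `ℝ²/ℤ²` (some integer
translate is within Euclidean distance `r`). [folklore] -/
def TorusClose (r x y x₀ y₀ : ℝ) : Prop :=
  ∃ p q : ℤ, (x - x₀ - p) ^ 2 + (y - y₀ - q) ^ 2 ≤ r ^ 2

end Welsh2018

open Welsh2018

/-- **Welsh 2018, Theorem 1 with Lemma 2 and the bounds of §5 — Hooley's parametrisation of the
roots of `X³ ≡ 2 (mod m)` (NAMED FACT, not proved here).** Printed (Thm 1, p. 9): for a root
`ν (mod m)`, with `(α)`, `α = a + b2^{1/3} + c2^{2/3} ∈ 𝒟`, the corresponding primitive ideal of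
`ℤ[2^{1/3}]` (Lemma 1) and `u, v, w` integers with `u(a²-2bc) + v(2c²-ab) + w(b²-ac) = 1` ((16)),
the points `((bu-cv)/(b²-ac), (bv-au)/(b²-ac))`, `((cv-au)/(2c²-ab), (2cu-bv)/(2c²-ab))`,
`((au-bv)/(a²-2bc), (av-2cu)/(a²-2bc))` "are all within `≪ 1/m` of the point `(ν/m, ν²/m)`";
Lemma 2 (p. 7): `m = a³+2b³+4c³-6abc` and `-ν = a(bw-av) + 2c(au-cw) + 2b(cv-bu)` (mod `m`);
§5 (p. 9): for `α ∈ 𝒟`, `b²-ac, 2c²-ab, a²-2bc ≍ m^{2/3}` and `a, b, c ≪ m^{1/3}`. VENDORED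
ELEMENTARY FORM with one absolute constant `C`: for every `m ≥ 1` and every integer `ν` with
`m ∣ ν³ - 2` there are integers `a b c u v w` with (i)–(vi) of the module docstring (distances on
`ℝ²/ℤ²` via `TorusClose`, sizes via `Real.rpow`). The existence of `α` uses that `ℤ[2^{1/3}]` is
the maximal order of the pure cubic field `ℚ(2^{1/3})` and has class number one (p. 7).
[cite: Welsh2018CubicCongruenceSpacing, Thm 1 (p. 9) with Lemma 2 (p. 7) and §5] -/
def Welsh2018_thm1 : Prop :=
  ∃ C : ℝ, 0 < C ∧ ∀ (m : ℕ) (ν : ℤ), 1 ≤ m → (m : ℤ) ∣ ν ^ 3 - 2 →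
    ∃ a b c u v w : ℤ,
      (m : ℤ) = a ^ 3 + 2 * b ^ 3 + 4 * c ^ 3 - 6 * a * b * c ∧
      u * (a ^ 2 - 2 * b * c) + v * (2 * c ^ 2 - a * b) + w * (b ^ 2 - a * c) = 1 ∧
      (m : ℤ) ∣ ν + (a * (b * w - a * v) + 2 * c * (a * u - c * w) + 2 * b * (c * v - b * u)) ∧
      (|(a : ℝ)| ≤ C * (m : ℝ) ^ ((1 : ℝ) / 3) ∧ |(b : ℝ)| ≤ C * (m : ℝ) ^ ((1 : ℝ) / 3) ∧
        |(c : ℝ)| ≤ C * (m : ℝ) ^ ((1 : ℝ) / 3)) ∧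
      ((m : ℝ) ^ ((2 : ℝ) / 3) / C ≤ |((b ^ 2 - a * c : ℤ) : ℝ)| ∧
        |((b ^ 2 - a * c : ℤ) : ℝ)| ≤ C * (m : ℝ) ^ ((2 : ℝ) / 3) ∧
        (m : ℝ) ^ ((2 : ℝ) / 3) / C ≤ |((2 * c ^ 2 - a * b : ℤ) : ℝ)| ∧
        |((2 * c ^ 2 - a * b : ℤ) : ℝ)| ≤ C * (m : ℝ) ^ ((2 : ℝ) / 3) ∧
        (m : ℝ) ^ ((2 : ℝ) / 3) / C ≤ |((a ^ 2 - 2 * b * c : ℤ) : ℝ)| ∧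
        |((a ^ 2 - 2 * b * c : ℤ) : ℝ)| ≤ C * (m : ℝ) ^ ((2 : ℝ) / 3)) ∧
      TorusClose (C / m) (((b * u - c * v : ℤ) : ℝ) / ((b ^ 2 - a * c : ℤ) : ℝ))
        (((b * v - a * u : ℤ) : ℝ) / ((b ^ 2 - a * c : ℤ) : ℝ)) ((ν : ℝ) / m) ((ν : ℝ) ^ 2 / m) ∧
      TorusClose (C / m) (((c * v - a * u : ℤ) : ℝ) / ((2 * c ^ 2 - a * b : ℤ) : ℝ))
        (((2 * c * u - b * v : ℤ) : ℝ) / ((2 * c ^ 2 - a * b : ℤ) : ℝ)) ((ν : ℝ) / m) ((ν : ℝ) ^ 2 / m) ∧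
      TorusClose (C / m) (((a * u - b * v : ℤ) : ℝ) / ((a ^ 2 - 2 * b * c : ℤ) : ℝ))
        (((a * v - 2 * c * u : ℤ) : ℝ) / ((a ^ 2 - 2 * b * c : ℤ) : ℝ)) ((ν : ℝ) / m) ((ν : ℝ) ^ 2 / m)

/-- **Welsh 2018, Theorem 2 — spacing of the points `(ν/m, ν²/m)` (NAMED FACT, not proved here).**
Printed (p. 11): "For any disc `D` in `ℝ²/ℤ²` with radius `1/M`, `#(S ∩ D) ≪ 1`, where
`S = {(ν/m, ν²/m) : ν³ ≡ 2 (mod m), M < m ≤ 2M}`." VENDORED: ∃ absolute `C` such that for every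
`M ≥ 1` and every centre `(x₀, y₀)`, the number of PAIRS `(m, ν)` with `M < m ≤ 2M`, `0 ≤ ν < m`,
`ν³ ≡ 2 (mod m)` and `(ν/m, ν²/m)` within `1/M` of `(x₀, y₀)` modulo `ℤ²` is at most `C` (for `M ≥ 1`
distinct pairs give distinct points of `S`, so this is the printed count).
[cite: Welsh2018CubicCongruenceSpacing, Thm 2 (p. 11)] -/
def Welsh2018_thm2 : Prop := by
  classical
  exact ∃ C : ℝ, ∀ (M : ℕ), 1 ≤ M → ∀ (x₀ y₀ : ℝ),
    (((Finset.Ioc M (2 * M)).sigma fun m => cubicRoots m).filter (fun p : (Σ _ : ℕ, ℕ) =>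
        TorusClose (1 / M) ((p.2 : ℝ) / p.1) ((p.2 : ℝ) ^ 2 / p.1) x₀ y₀)).card ≤ C

/-- **Welsh 2018, Theorem 3 — a large sieve type inequality for the roots of `X³ ≡ 2 (mod m)`
(NAMED FACT, not proved here).** Printed (p. 12): "For any sequence of complex numbers `a_{k,l}`
supported in positive integers `k ≤ K` and `l ≤ L`, we have
`∑_{M<m≤2M} ∑_{ν³≡2 (m)} |∑_k ∑_l a_{k,l} e((kν + lν²)/m)|² ≪ (M+K)(M+L) ∑_k ∑_l |a_{k,l}|²`."
VENDORED with an absolute constant `C` (independent of `M, K, L ≥ 1` and of `a`), `e(t) = e^{2πit}`,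
`ν` running over `cubicRoots m` (`0 ≤ ν < m`). Proof in print: duality + Theorem 2.
[cite: Welsh2018CubicCongruenceSpacing, Thm 3 (p. 12)] -/
def Welsh2018_thm3 : Prop :=
  ∃ C : ℝ, ∀ (M K L : ℕ), 1 ≤ M → 1 ≤ K → 1 ≤ L → ∀ a : ℕ → ℕ → ℂ,
    ∑ m ∈ Finset.Ioc M (2 * M), ∑ ν ∈ cubicRoots m,
        ‖∑ k ∈ Finset.Icc 1 K, ∑ l ∈ Finset.Icc 1 L,
          a k l * Complex.exp (2 * Real.pi * Complex.I * ((k * ν + l * ν ^ 2 : ℕ) / m : ℂ))‖ ^ 2 ≤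
      C * ((M : ℝ) + K) * ((M : ℝ) + L) * ∑ k ∈ Finset.Icc 1 K, ∑ l ∈ Finset.Icc 1 L, ‖a k l‖ ^ 2

end Literature.NumberTheory.Sieve
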